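import Literature.Computability.MetaComplexity.BoundedArithUnivEngine
import HarnessLib

/-!
# Strict `Σᵇ` forms in Herbrand-saturated models of the universal theory

Topic `Literature/Computability/MetaComplexity` (continuation of `BoundedArithUnivEngine.lean`).
In a Herbrand-saturated model `K` of `QSym.univTheory k` every `Σᵇₖ₊₂` formula of Buss's
language (context variables, no parameters) is equivalent to a **strict** form
`∃ w ≤ r(x̄) π(x̄, w)` with `r` a term of Buss's language and `π` an *open* formula of
`Language.qsym k` (`QSym.HasStrictForm`), and the negation of every `Πᵇₖ₊₂` formula likewise
(`QSym.hasStrictForm_of_isSigmab_and_of_isPib`) — the model-theoretic content of Buss 1990,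
§4, Prop. 14 and Prop. 16 (pp. 15–16: `A(ā) ↔ (∃w ≤ t_A) Witness_A(w, ā)`, with
`T₂ⁱ ⊢ (∃w) Witness_A → A` and `T₂ⁱ + Σᵇᵢ₊₁-replacement ⊢ A → (∃w ≤ t_A) Witness_A`) and of
Buss 1986, §2.7, with the witnessing matrix made open by the symbols of the universal extension.
Accordingly a strict form has two directions: decoding (`∃w ≤ r π → A`, in every model of the
theory) and coding (`A → ∃w ≤ r π`, in Herbrand-saturated models, where replacement is
available through Herbrand's theorem):

* `Σᵇₖ₊₁ ∪ Πᵇₖ₊₁` formulas are open via their characteristic symbols (`realize_iff_chi_eq_one`);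
* disjunctions: add the bounds;
* a bounded existential in front of a strict form (and conjunctions): code the two witnesses by
  `exists_collect` (a code with a decoder uniform in the parameters);
* a sharply bounded universal in front of a strict form: collect the witnesses by
  `exists_collect` and express the sharply bounded universal over the open matrix by the
  least-zero symbol (`forall_le_len_iff_lt_lsearch`).

Consequence (`QSym.exists_universal_of_isPib`): every `Πᵇₖ₊₂` formula is equivalent in `K` to a
universal formula of `Language.qsym k` — the field `exists_universal` of `HerbrandRouteData`.

## References

* S. R. Buss, *Axiomatizations and conservation results for fragments of bounded arithmetic*,
  Contemp. Math. 106, AMS 1990, §4, Prop. 14, Prop. 16 (pp. 15–16), Thm. 5.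
* S. R. Buss, *Bounded Arithmetic*, Bibliopolis 1986, §2.7.
-/

namespace Literature.Computability.MetaComplexity

open FirstOrder FirstOrder.Language FirstOrder.Language.BoundedFormula
open Literature.ModelTheory.UniversalTheories

namespace QSym

open BASICModel

variable {k : ℕ} {K : Type} [Language.boundedArith.Structure K] [(Language.qsym k).Structure K]
  [(qsymι k).IsExpansionOn K]

/-! ## Substituting terms for context variables -/

section SubstCtx

variable {n m : ℕ}

omit [Language.boundedArith.Structure K] [(Language.qsym k).Structure K] [(qsymι k).IsExpansionOn K] in
/-- Substitution of free variables preserves openness. [folklore] -/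
theorem isQF_subst {L' : Language} {α β : Type} {l : ℕ}
    {φ : L'.BoundedFormula α l} (h : φ.IsQF) (tf : α → L'.Term β) : (φ.subst tf).IsQF := by
  induction h with
  | falsum => exact IsQF.falsum
  | of_isAtomic h =>
    cases h with
    | equal t₁ t₂ => exact (IsAtomic.equal _ _).isQF
    | rel R ts => exact (IsAtomic.rel _ _).isQF
  | imp _ _ ih₁ ih₂ => exact ih₁.imp ih₂

/-- **Substituting terms for the context variables** of a formula in context variables:
`substCtx π σ` is `π(σ₀, …, σ_{n-1})`, a formula in the context of the `σᵢ`. [folklore] -/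
def substCtx (π : (Language.qsym k).BoundedFormula Empty n)
    (σ : Fin n → (Language.qsym k).Term (Empty ⊕ Fin m)) : (Language.qsym k).BoundedFormula Empty m :=
  BoundedFormula.relabel (id : Empty ⊕ Fin m → Empty ⊕ Fin m)
    ((π.toFormula).subst (Sum.elim (fun e => e.elim) σ))

omit [Language.boundedArith.Structure K] [(Language.qsym k).Structure K] [(qsymι k).IsExpansionOn K] in
/-- `substCtx` preserves openness. [folklore] -/
theorem isQF_substCtx {π : (Language.qsym k).BoundedFormula Empty n} (hπ : π.IsQF)
    (σ : Fin n → (Language.qsym k).Term (Empty ⊕ Fin m)) : (substCtx π σ).IsQF :=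
  (isQF_subst hπ.toFormula _).relabel _

omit [Language.boundedArith.Structure K] [(qsymι k).IsExpansionOn K] in
/-- Semantics of `substCtx`. [folklore] -/
theorem realize_substCtx (π : (Language.qsym k).BoundedFormula Empty n)
    (σ : Fin n → (Language.qsym k).Term (Empty ⊕ Fin m)) (ys : Fin m → K) :
    (substCtx π σ).Realize default ys ↔
      π.Realize default fun i => (σ i).realize (Sum.elim default ys) := by
  rw [substCtx, realize_relabel]
  have e0 : (ys ∘ Fin.natAdd m : Fin 0 → K) = default := Subsingleton.elim _ _
  have e1 : (ys ∘ Fin.castAdd 0) = ys := by funext i; simp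
  rw [e0, e1, Function.comp_id]
  refine (realize_subst (φ := π.toFormula) (v := Sum.elim default ys) (xs := default)).trans ?_
  refine (realize_toFormula π _).trans ?_
  have e2 : ((fun a => Term.realize (Sum.elim (default : Empty → K) ys)
      (Sum.elim (fun e => e.elim) σ a)) ∘ Sum.inl) = (default : Empty → K) := Subsingleton.elim _ _
  rw [e2]
  rfl

end SubstCtx

/-! ## Monotonicity of the terms of Buss's language -/

section Mono

variable [hKB : K ⊨ BASIC]

/-- **`⌊·/2⌋` is monotone in `K`** (a universal sentence true in all models of
`BASIC + Σᵇ₁-IND`, transferred). [folklore] -/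
theorem mHalf_mono (hK : K ⊨ univTheory k) {a b : K} (h : a ≤ b) : mHalf a ≤ mHalf b := by
  let σ : Language.boundedArith.Sentence :=
    BoundedFormula.alls (n := 2) (Term.le (&0) (&1) ⟹ Term.le (Term.half (&0)) (Term.half (&1)))
  have hσ : σ.IsUniversal :=
    BoundedFormula.IsQF.isUniversal_alls ((IsAtomic.rel _ _).isQF.imp (IsAtomic.rel _ _).isQF)
  have hKσ := realize_sentence_of_fact hK hσ (fun N _ _ _ _ => by
    simp only [σ, Sentence.Realize, realize_alls, realize_imp, realize_le', realize_term_half,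
      mLe_iff]
    intro xs hle
    exact mHalf_le_mHalf hle)
  simp only [σ, Sentence.Realize, realize_alls, realize_imp, realize_le', realize_term_half,
    mLe_iff] at hKσ
  exact hKσ ![a, b] h

/-- **`#` is monotone in `K`** (transferred from the models of `BASIC + Σᵇ₁-IND`, where it follows
from axioms 17–18 and the existence of powers of two). [cite: Buss1986, §2.3] -/
theorem mSmash_mono (hK : K ⊨ univTheory k) {a a' b b' : K} (ha : a ≤ a') (hb : b ≤ b') :
    mSmash a b ≤ mSmash a' b' := by
  let σ : Language.boundedArith.Sentence :=
    BoundedFormula.alls (n := 4) ((Term.le (&0) (&1) ⊓ Term.le (&2) (&3)) ⟹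
      Term.le (Term.smash (&0) (&2)) (Term.smash (&1) (&3)))
  have hσ : σ.IsUniversal :=
    BoundedFormula.IsQF.isUniversal_alls
      (((IsAtomic.rel _ _).isQF.inf (IsAtomic.rel _ _).isQF).imp (IsAtomic.rel _ _).isQF)
  have hKσ := realize_sentence_of_fact hK hσ (fun N _ _ _ _ => by
    simp only [σ, Sentence.Realize, realize_alls, realize_imp, realize_inf,
      realize_le', realize_term_smash, mLe_iff]
    rintro xs ⟨h1, h2⟩
    exact mSmash_le_mSmash h1 h2)
  simp only [σ, Sentence.Realize, realize_alls, realize_imp, realize_inf,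
    realize_le', realize_term_smash, mLe_iff] at hKσ
  exact hKσ ![a, a', b, b'] ⟨ha, hb⟩

/-- **The terms of Buss's language are monotone in `K`**: pointwise larger arguments give a
larger value. [cite: Buss1986, §2.2] -/
theorem realize_mono (hK : K ⊨ univTheory k) {α : Type} (t : Language.boundedArith.Term α)
    {v v' : α → K} (h : ∀ a, v a ≤ v' a) : t.realize v ≤ t.realize v' := by
  induction t with
  | var a => exact h a
  | func f ts ih =>
    simp only [Term.realize]
    have e1 : ∀ (w : Fin 1 → K), w = ![w 0] := fun w => by funext i; fin_cases i; rfl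
    have e2 : ∀ (w : Fin 2 → K), w = ![w 0, w 1] := fun w => by funext i; fin_cases i <;> rfl
    cases f with
    | zero => exact le_of_eq (congrArg _ (funext fun i => Fin.elim0 i))
    | succ =>
      rw [e1 (fun i => (ts i).realize v), e1 (fun i => (ts i).realize v')]
      change mSucc _ ≤ mSucc _
      rw [mSucc_eq, mSucc_eq]
      exact add_le_add (ih 0) le_rfl
    | half =>
      rw [e1 (fun i => (ts i).realize v), e1 (fun i => (ts i).realize v')]
      exact mHalf_mono hK (ih 0)
    | len =>
      rw [e1 (fun i => (ts i).realize v), e1 (fun i => (ts i).realize v')]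
      exact mLen_le_mLen (ih 0)
    | add =>
      rw [e2 (fun i => (ts i).realize v), e2 (fun i => (ts i).realize v')]
      change mAdd _ _ ≤ mAdd _ _
      rw [mAdd_eq, mAdd_eq]
      exact add_le_add (ih 0) (ih 1)
    | mul =>
      rw [e2 (fun i => (ts i).realize v), e2 (fun i => (ts i).realize v')]
      change mMul _ _ ≤ mMul _ _
      rw [mMul_eq, mMul_eq]
      exact mul_le_mul'' (ih 0) (ih 1)
    | smash =>
      rw [e2 (fun i => (ts i).realize v), e2 (fun i => (ts i).realize v')]
      exact mSmash_mono hK (ih 0) (ih 1)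

end Mono

/-! ## A sharply bounded universal over a symbol is open -/

section ForallLen

variable {n : ℕ} [hKB : K ⊨ BASIC]

/-- **A sharply bounded universal quantifier over a `0/1`-valued symbol is open**:
`(∀ z ≤ |s(x̄)|, g(x̄, z) = 1) ↔ |s(x̄)| < lsearch g s (x̄)`. [folklore] -/
theorem forall_le_len_iff_lt_lsearch (hK : K ⊨ univTheory k) (g : QSym k (n + 1))
    (s : Language.boundedArith.Term (Empty ⊕ Fin n)) (xs : Fin n → K)
    (h01 : ∀ z, app g (Fin.snoc xs z) = 0 ∨ app g (Fin.snoc xs z) = 1) :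
    (∀ z, z ≤ mLen (s.realize (Sum.elim default xs)) → app g (Fin.snoc xs z) = 1) ↔
      mLen (s.realize (Sum.elim default xs)) < app (lsearch g s) xs := by
  have h0ne : (0 : K) ≠ 1 := zero_ne_one
  constructor
  · intro hall
    by_contra hle
    push Not at hle
    have h0 := eq_zero_of_lsearch_le hK g s xs hle
    have h1 := hall _ hle
    rw [h0] at h1
    exact h0ne h1
  · intro hlt z hz
    rcases h01 z with h0 | h1
    · exact absurd (lsearch_le_of_eq_zero hK g s xs hz h0) (not_le.2 (lt_of_le_of_lt hz hlt))
    · exact h1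

end ForallLen

/-! ## Strict forms (uniform in the model) -/

section Strict

variable {n : ℕ}

/-- A predicate on `n`-tuples, in every structure for both languages (the shape of
"`θ(x̄)` holds", uniformly in the model). [folklore] -/
def StrictPred (k n : ℕ) : Type 1 :=
  ∀ (K : Type) [Language.boundedArith.Structure K] [(Language.qsym k).Structure K], (Fin n → K) → Prop

/-- **Strict `Σᵇ` form**, uniformly in the model: a term `r` (Buss's language) and an open `π`
(`Language.qsym k`, context variables) such that `∃ w ≤ r(x̄), π(x̄, w) → A(x̄)` in every model
`K` of `univTheory k` (with `K ⊨ BASIC` on a compatible reduct), and conversely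
`A(x̄) → ∃ w ≤ r(x̄), π(x̄, w)` in every *Herbrand-saturated* such model (the two halves of
Buss 1990, Prop. 16). [cite: BussContempMath1990, §4, Prop. 16 (p. 16)] -/
def HasStrictForm (k : ℕ) {n : ℕ} (A : StrictPred k n) : Prop :=
  ∃ (r : Language.boundedArith.Term (Empty ⊕ Fin n)) (π : (Language.qsym k).BoundedFormula Empty (n + 1)),
    π.IsQF ∧
    (∀ (K : Type) [Language.boundedArith.Structure K] [(Language.qsym k).Structure K]
      [(qsymι k).IsExpansionOn K] [K ⊨ BASIC], K ⊨ univTheory k → ∀ xs : Fin n → K,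
        (∃ w, w ≤ r.realize (Sum.elim default xs) ∧ π.Realize default (Fin.snoc xs w)) → A K xs) ∧
    (∀ (K : Type) [Language.boundedArith.Structure K] [(Language.qsym k).Structure K]
      [(qsymι k).IsExpansionOn K] [K ⊨ BASIC], K ⊨ univTheory k →
      IsHerbrandSaturated (Language.qsym k) K → ∀ xs : Fin n → K,
        A K xs → ∃ w, w ≤ r.realize (Sum.elim default xs) ∧ π.Realize default (Fin.snoc xs w))

/-- **Transport of strict forms**: if `A → B` in all models of the theory and `B → A` in the
Herbrand-saturated ones, a strict form of `A` is one of `B`. [folklore] -/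
theorem HasStrictForm.of_imp {A B : StrictPred k n} (h : HasStrictForm k A)
    (hAB : ∀ (K : Type) [Language.boundedArith.Structure K] [(Language.qsym k).Structure K]
      [(qsymι k).IsExpansionOn K] [K ⊨ BASIC], K ⊨ univTheory k → ∀ xs : Fin n → K, A K xs → B K xs)
    (hBA : ∀ (K : Type) [Language.boundedArith.Structure K] [(Language.qsym k).Structure K]
      [(qsymι k).IsExpansionOn K] [K ⊨ BASIC], K ⊨ univTheory k →
      IsHerbrandSaturated (Language.qsym k) K → ∀ xs : Fin n → K, B K xs → A K xs) :
    HasStrictForm k B := by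
  obtain ⟨r, π, hπ, hA, hA'⟩ := h
  exact ⟨r, π, hπ, fun K _ _ _ _ hK xs h => hAB K hK xs (hA K hK xs h),
    fun K _ _ _ _ hK hsat xs h => hA' K hK hsat xs (hBA K hK hsat xs h)⟩

/-- Strict forms are invariant under (uniform) equivalence of predicates. [folklore] -/
theorem HasStrictForm.of_iff {A B : StrictPred k n} (h : HasStrictForm k A)
    (hAB : ∀ (K : Type) [Language.boundedArith.Structure K] [(Language.qsym k).Structure K]
      [(qsymι k).IsExpansionOn K] [K ⊨ BASIC], K ⊨ univTheory k → ∀ xs : Fin n → K, A K xs ↔ B K xs) :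
    HasStrictForm k B := by
  obtain ⟨r, π, hπ, hA, hA'⟩ := h
  exact ⟨r, π, hπ, fun K _ _ _ _ hK xs h => (hAB K hK xs).1 (hA K hK xs h),
    fun K _ _ _ _ hK hsat xs h => hA' K hK hsat xs ((hAB K hK xs).2 h)⟩

/-- **An open predicate is strict** (dummy witness `w ≤ 0`). [folklore] -/
theorem hasStrictForm_of_isQF {ρ : (Language.qsym k).BoundedFormula Empty n} (hρ : ρ.IsQF) :
    HasStrictForm k fun K _ _ xs => ρ.Realize (default : Empty → K) xs := by
  refine ⟨0, substCtx ρ fun i => qv (Fin.castSucc i), isQF_substCtx hρ _,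
    fun K _ _ _ _ hK xs => ?_, fun K _ _ _ _ hK hsat xs => ?_⟩
  · simp only [realize_term_zero, mZero_eq, realize_substCtx, Term.realize, Sum.elim_inr,
      Fin.snoc_castSucc]
    exact fun ⟨_, _, h⟩ => h
  · simp only [realize_term_zero, mZero_eq, realize_substCtx, Term.realize, Sum.elim_inr,
      Fin.snoc_castSucc]
    exact fun h => ⟨0, le_rfl, h⟩

/-- **`Σᵇₖ₊₁ ∪ Πᵇₖ₊₁` formulas are strict** (open via the characteristic symbol), and so are
their negations. [folklore] -/
theorem hasStrictForm_of_cert {θ : Language.boundedArith.BoundedFormula Empty n}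
    (h : IsSigmab (k + 1) θ ∨ IsPib (k + 1) θ) :
    HasStrictForm k (fun K _ _ xs => θ.Realize (default : Empty → K) xs) ∧
      HasStrictForm k (fun K _ _ xs => ¬ θ.Realize (default : Empty → K) xs) := by
  have hqf : (Term.bdEqual (chiTerm θ h) qone : (Language.qsym k).BoundedFormula Empty n).IsQF :=
    (IsAtomic.equal _ _).isQF
  have hsem : ∀ (K : Type) [Language.boundedArith.Structure K] [(Language.qsym k).Structure K]
      [(qsymι k).IsExpansionOn K] [K ⊨ BASIC] (xs : Fin n → K),
      (Term.bdEqual (chiTerm θ h) qone : (Language.qsym k).BoundedFormula Empty n).Realize default xs ↔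
        app (chi θ h) xs = 1 := by
    intro K _ _ _ _ xs
    simp only [realize_bdEqual, Term.realize, Sum.elim_inr, realize_qone]
  constructor
  · refine (hasStrictForm_of_isQF hqf).of_iff fun K _ _ _ _ hK xs => ?_
    show _ ↔ θ.Realize default xs
    rw [hsem, realize_iff_chi_eq_one hK h xs]
  · refine (hasStrictForm_of_isQF hqf.not).of_iff fun K _ _ _ _ hK xs => ?_
    show (∼ _).Realize _ _ ↔ ¬ θ.Realize default xs
    rw [realize_not, hsem, realize_iff_chi_eq_one hK h xs]

/-- **Disjunction of strict forms** (bound `r₁ + r₂`). [folklore] -/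
theorem HasStrictForm.or {A B : StrictPred k n} (hA : HasStrictForm k A) (hB : HasStrictForm k B) :
    HasStrictForm k fun K _ _ xs => A K xs ∨ B K xs := by
  obtain ⟨r₁, π₁, hπ₁, h₁⟩ := hA
  obtain ⟨r₂, π₂, hπ₂, h₂⟩ := hB
  let w : (Language.qsym k).Term (Empty ⊕ Fin (n + 1)) := qv (Fin.last n)
  let up : Language.boundedArith.Term (Empty ⊕ Fin n) → (Language.qsym k).Term (Empty ⊕ Fin (n + 1)) :=
    fun t => ιt (t.relabel (Sum.map id Fin.castSucc))
  obtain ⟨h₁', h₁⟩ := h₁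
  obtain ⟨h₂', h₂⟩ := h₂
  have sem : ∀ (K : Type) [Language.boundedArith.Structure K] [(Language.qsym k).Structure K]
      [(qsymι k).IsExpansionOn K] [K ⊨ BASIC] (xs : Fin n → K) (v : K),
      ((Term.le w (up r₁) ⊓ π₁) ⊔ (Term.le w (up r₂) ⊓ π₂)).Realize default (Fin.snoc xs v) ↔
        (v ≤ r₁.realize (Sum.elim default xs) ∧ π₁.Realize default (Fin.snoc xs v)) ∨
          (v ≤ r₂.realize (Sum.elim default xs) ∧ π₂.Realize default (Fin.snoc xs v)) := by
    intro K _ _ _ _ xs v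
    simp only [realize_sup, realize_inf, realize_qle, Term.realize, Sum.elim_inr, Fin.snoc_last,
      realize_ιt, Term.realize_relabel, Sum.elim_comp_map, Function.comp_id, Fin.snoc_comp_castSucc,
      w, up]
  refine ⟨r₁ + r₂, (Term.le w (up r₁) ⊓ π₁) ⊔ (Term.le w (up r₂) ⊓ π₂),
    ((IsAtomic.rel _ _).isQF.inf hπ₁).sup ((IsAtomic.rel _ _).isQF.inf hπ₂),
    fun K _ _ _ _ hK xs => ?_, fun K _ _ _ _ hK hsat xs => ?_⟩
  · rintro ⟨v, -, hv⟩
    rw [sem] at hv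
    rcases hv with ⟨hv, hπ⟩ | ⟨hv, hπ⟩
    · exact Or.inl (h₁' K hK xs ⟨v, hv, hπ⟩)
    · exact Or.inr (h₂' K hK xs ⟨v, hv, hπ⟩)
  · show A K xs ∨ B K xs → _
    simp only [realize_term_add, mAdd_eq, sem]
    rintro (hA | hB)
    · obtain ⟨v, hv, hπ⟩ := h₁ K hK hsat xs hA
      exact ⟨v, hv.trans (le_add_right'' _ _), Or.inl ⟨hv, hπ⟩⟩
    · obtain ⟨v, hv, hπ⟩ := h₂ K hK hsat xs hB
      exact ⟨v, hv.trans (le_add_left'' _ _), Or.inr ⟨hv, hπ⟩⟩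

end Strict

/-! ## A bounded existential in front of a strict form: coding two witnesses -/

section Bex

variable {n : ℕ}

/-- Substituting a term for the last context variable of a term of Buss's language. [folklore] -/
def substLastBA (r : Language.boundedArith.Term (Empty ⊕ Fin (n + 1)))
    (t : Language.boundedArith.Term (Empty ⊕ Fin n)) : Language.boundedArith.Term (Empty ⊕ Fin n) :=
  r.subst (Sum.elim (fun e => e.elim) (Fin.snoc (fun i => Term.var (Sum.inr i)) t))

omit [(Language.qsym k).Structure K] [(qsymι k).IsExpansionOn K] in
/-- Semantics of `substLastBA`. [folklore] -/
@[simp] theorem realize_substLastBA (r : Language.boundedArith.Term (Empty ⊕ Fin (n + 1)))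
    (t : Language.boundedArith.Term (Empty ⊕ Fin n)) (xs : Fin n → K) :
    (substLastBA r t).realize (Sum.elim default xs) =
      r.realize (Sum.elim default (Fin.snoc xs (t.realize (Sum.elim default xs)))) := by
  rw [substLastBA, Term.realize_subst]
  congr 1
  funext a
  rcases a with e | i
  · exact e.elim
  · cases i using Fin.lastCases with
    | last => simp
    | cast i => simp

/-- Lifting a term of Buss's language over `x̄` to a `Language.qsym k`-term over `(x̄, v)`.
[folklore] -/
abbrev upT (t : Language.boundedArith.Term (Empty ⊕ Fin n)) : (Language.qsym k).Term (Empty ⊕ Fin (n + 1)) :=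
  ιt (t.relabel (Sum.map id Fin.castSucc))

/-- Semantics of `upT` in `K`. [folklore] -/
@[simp] theorem realize_upT (t : Language.boundedArith.Term (Empty ⊕ Fin n)) (xs : Fin n → K) (v : K) :
    (upT (k := k) t).realize (Sum.elim default (Fin.snoc xs v)) = t.realize (Sum.elim default xs) := by
  simp [upT, Term.realize_relabel, Sum.elim_comp_map, Fin.snoc_comp_castSucc]

variable [hKB : K ⊨ BASIC]

omit [(Language.qsym k).Structure K] [(qsymι k).IsExpansionOn K] in
/-- `|1 + 1 + 1| = 1 + 1` in a model of `BASIC`. [folklore] -/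
theorem mLen_three : mLen (1 + 1 + 1 : K) = 1 + 1 := by
  have e : (1 + 1 + 1 : K) = 2 * 1 + 1 := by rw [two_mul]
  rw [e, mLen_two_mul_add_one, mLen_one]

/-- **A bounded existential quantifier in front of a strict form is strict**: the two witnesses
`y ≤ t(x̄)` and `w ≤ r_A(x̄, y)` are coded into one (`exists_collect` with two steps), decoded by
`seqel` with parameters depending only on `x̄` (bound `B₀ = t + r_A(x̄, t(x̄))`, by monotonicity
of terms). [cite: Buss1986, §2.7] -/
theorem HasStrictForm.bex (t : Language.boundedArith.Term (Empty ⊕ Fin n)) {A : StrictPred k (n + 1)}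
    (hA : HasStrictForm k A) :
    HasStrictForm k fun K _ _ xs => ∃ y, MLe y (t.realize (Sum.elim (default : Empty → K) xs)) ∧
      A K (Fin.snoc xs y) := by
  obtain ⟨rA, πA, hπA, hAback, hAforth⟩ := hA
  -- bounds (terms of Buss's language over `x̄`)
  let B₀ : Language.boundedArith.Term (Empty ⊕ Fin n) := t + substLastBA rA t
  let bT : Language.boundedArith.Term (Empty ⊕ Fin n) := Term.succ (natConst 2)
  let ST : Language.boundedArith.Term (Empty ⊕ Fin n) :=
    Term.smash (Term.succ (bT + bT)) (Term.succ (B₀ + B₀))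
  let r : Language.boundedArith.Term (Empty ⊕ Fin n) := Term.succ (ST + ST)
  -- decoding terms over `(x̄, v)`
  let vv : (Language.qsym k).Term (Empty ⊕ Fin (n + 1)) := qv (Fin.last n)
  let yv : (Language.qsym k).Term (Empty ⊕ Fin (n + 1)) :=
    Term.func (seqel : QSym k 4) ![upT ST, upT (Term.len B₀), vv, qone]
  let wv : (Language.qsym k).Term (Empty ⊕ Fin (n + 1)) :=
    Term.func (seqel : QSym k 4) ![upT ST, upT (Term.len B₀), vv,
      Functions.apply₂ (QSym.ba BoundedArithFunc.add : QSym k 2) qone qone]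
  let rAy : (Language.qsym k).Term (Empty ⊕ Fin (n + 1)) :=
    (ιt rA).subst (Sum.elim (fun e => Term.var (Sum.inl e)) (Fin.snoc (fun i => qv (Fin.castSucc i)) yv))
  let π : (Language.qsym k).BoundedFormula Empty (n + 1) :=
    (Term.le yv (upT t) ⊓ Term.le wv rAy) ⊓
      substCtx πA (Fin.snoc (Fin.snoc (fun i => qv (Fin.castSucc i)) yv) wv)
  have hπ : π.IsQF :=
    ((IsAtomic.rel _ _).isQF.inf (IsAtomic.rel _ _).isQF).inf (isQF_substCtx hπA _)
  -- semantics of `π` (in any model)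
  have sem : ∀ (K : Type) [Language.boundedArith.Structure K] [(Language.qsym k).Structure K]
      [(qsymι k).IsExpansionOn K] [K ⊨ BASIC] (xs : Fin n → K) (v : K),
      π.Realize default (Fin.snoc xs v) ↔
      (app (seqel (k := k)) ![ST.realize (Sum.elim default xs), mLen (B₀.realize (Sum.elim default xs)), v, 1] ≤
          t.realize (Sum.elim default xs) ∧
        app (seqel (k := k)) ![ST.realize (Sum.elim default xs), mLen (B₀.realize (Sum.elim default xs)), v, 1 + 1] ≤
          rA.realize (Sum.elim default (Fin.snoc xs
            (app (seqel (k := k)) ![ST.realize (Sum.elim default xs), mLen (B₀.realize (Sum.elim default xs)), v, 1])))) ∧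
      πA.Realize default (Fin.snoc (Fin.snoc xs
        (app (seqel (k := k)) ![ST.realize (Sum.elim default xs), mLen (B₀.realize (Sum.elim default xs)), v, 1]))
        (app (seqel (k := k)) ![ST.realize (Sum.elim default xs), mLen (B₀.realize (Sum.elim default xs)), v, 1 + 1])) := by
    intro K _ _ _ _ xs v
    have hyv : yv.realize (Sum.elim default (Fin.snoc xs v)) =
        app (seqel (k := k)) ![ST.realize (Sum.elim default xs), mLen (B₀.realize (Sum.elim default xs)), v, 1] := by
      simp only [yv]
      rw [realize_func_vec4]
      simp only [realize_upT, realize_term_len, vv, Term.realize, Sum.elim_inr, Fin.snoc_last,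
        realize_qone]
    have hwv : wv.realize (Sum.elim default (Fin.snoc xs v)) =
        app (seqel (k := k)) ![ST.realize (Sum.elim default xs), mLen (B₀.realize (Sum.elim default xs)), v, 1 + 1] := by
      simp only [wv]
      rw [realize_func_vec4]
      simp only [realize_upT, realize_term_len, vv, Term.realize, Sum.elim_inr, Fin.snoc_last,
        realize_qone, Term.realize_functions_apply₂, funMap_ba]
      rw [show Structure.funMap (L := Language.boundedArith) BoundedArithFunc.add ![(1 : K), 1] = 1 + 1
        from mAdd_eq 1 1]
    have hrAy : rAy.realize (Sum.elim default (Fin.snoc xs v)) =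
        rA.realize (Sum.elim default (Fin.snoc xs
          (app (seqel (k := k)) ![ST.realize (Sum.elim default xs), mLen (B₀.realize (Sum.elim default xs)), v, 1]))) := by
      rw [show rAy = (ιt rA).subst _ from rfl, Term.realize_subst, realize_ιt]
      congr 1
      funext a
      rcases a with e | i
      · exact e.elim
      · cases i using Fin.lastCases with
        | last => simp only [Sum.elim_inr, Fin.snoc_last]; exact hyv
        | cast i => simp
    simp only [π, realize_inf, realize_qle, realize_upT, hyv, hwv, hrAy, realize_substCtx,
      realize_snoc_terms, Term.realize, Sum.elim_inr, Fin.snoc_castSucc]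
  refine ⟨r, π, hπ, fun K _ _ _ _ hK xs => ?_, fun K _ _ _ _ hK hsat xs => ?_⟩
  · -- decoding direction (any model)
    rintro ⟨v, -, hv⟩
    rw [sem] at hv
    obtain ⟨⟨h1, h2⟩, h3⟩ := hv
    exact ⟨_, (mLe_iff _ _).2 h1, hAback K hK _ ⟨_, h2, h3⟩⟩
  · -- coding direction (Herbrand-saturated model)
    rintro ⟨y, hy, hAy⟩
    rw [mLe_iff] at hy
    obtain ⟨w, hw, hπw⟩ := hAforth K hK hsat (Fin.snoc xs y) hAy
    set R : K := B₀.realize (Sum.elim default xs) with hR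
    set Sv : K := ST.realize (Sum.elim default xs) with hSv
    have hbT : bT.realize (Sum.elim (default : Empty → K) xs) = 1 + 1 + 1 := by
      simp [bT, mSucc_eq]
    have hST : Sv = mSmash ((1 + 1 + 1) + (1 + 1 + 1) + 1) (R + R + 1) := by
      simp [hSv, ST, hbT, mSucc_eq, mAdd_eq, hR]
    have hr : r.realize (Sum.elim (default : Empty → K) xs) = Sv + Sv + 1 := by
      simp [r, mSucc_eq, mAdd_eq, hSv]
    have hRt : t.realize (Sum.elim (default : Empty → K) xs) ≤ R := by
      simp only [hR, B₀, realize_term_add, mAdd_eq]; exact le_add_right'' _ _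
    have hRr : rA.realize (Sum.elim default (Fin.snoc xs y)) ≤ R := by
      simp only [hR, B₀, realize_term_add, mAdd_eq, realize_substLastBA]
      refine le_trans (realize_mono hK rA fun a => ?_) (le_add_left'' _ _)
      rcases a with e | i
      · exact le_rfl
      · cases i using Fin.lastCases with
        | last => simpa using hy
        | cast i => simp
    -- code `(y, w)` by a two-step collection
    let pa : Fin (n + 2) → K := Fin.snoc (Fin.snoc xs y) w
    let jx : (Language.qsym k).Term (Empty ⊕ Fin (n + 2 + 3)) := qv ((Fin.last (n + 2)).castSucc.castSucc)
    let ux : (Language.qsym k).Term (Empty ⊕ Fin (n + 2 + 3)) := qv (Fin.last (n + 4))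
    let yx : (Language.qsym k).Term (Empty ⊕ Fin (n + 2 + 3)) :=
      qv ((Fin.last n).castSucc.castSucc.castSucc.castSucc)
    let wx : (Language.qsym k).Term (Empty ⊕ Fin (n + 2 + 3)) :=
      qv ((Fin.last (n + 1)).castSucc.castSucc.castSucc)
    let Θ : (Language.qsym k).BoundedFormula Empty (n + 2 + 3) :=
      (Term.bdEqual jx (ιt 0) ⟹ Term.bdEqual ux yx) ⊓ (Term.bdEqual jx qone ⟹ Term.bdEqual ux wx)
    have hΘ : Θ.IsQF :=
      ((IsAtomic.equal _ _).isQF.imp (IsAtomic.equal _ _).isQF).inf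
        ((IsAtomic.equal _ _).isQF.imp (IsAtomic.equal _ _).isQF)
    have hΘsem : ∀ j u u' : K, Θ.Realize default (Fin.snoc (Fin.snoc (Fin.snoc pa j) u) u') ↔
        (j = 0 → u' = y) ∧ (j = 1 → u' = w) := by
      intro j u u'
      simp [Θ, jx, ux, yx, wx, pa, Term.realize, Fin.snoc_castSucc, Fin.snoc_last, mSucc_eq]
    have htot : ∀ j u : K, ∃ u' : K, Θ.Realize default (Fin.snoc (Fin.snoc (Fin.snoc pa j) u) u') := by
      intro j u
      by_cases hj : j = 0
      · exact ⟨y, (hΘsem j u y).2 ⟨fun _ => rfl, fun h1 => absurd (hj.symm.trans h1) zero_ne_one⟩⟩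
      · exact ⟨w, (hΘsem j u w).2 ⟨fun h0 => absurd h0 hj, fun _ => rfl⟩⟩
    obtain ⟨W, hWle, hW0, hWstep⟩ := exists_collect hK hsat hΘ pa htot (1 + 1 + 1) R
    rw [← hST] at hWle hW0 hWstep
    have hlen : mLen (1 + 1 + 1 : K) = 1 + 1 := mLen_three
    -- digit 1 = y
    have hd1 : app (seqel (k := k)) ![Sv, mLen R, W, 1] = y := by
      obtain ⟨y', hy', hy'le⟩ := hWstep 0 (by rw [hlen]; exact add_pos' zero_lt_one zero_lt_one)
      rw [hΘsem] at hy'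
      have e := hy'.1 rfl
      subst e
      simpa using hy'le (hy.trans hRt)
    -- digit 2 = w
    have hd2 : app (seqel (k := k)) ![Sv, mLen R, W, 1 + 1] = w := by
      obtain ⟨y', hy', hy'le⟩ := hWstep 1 (by rw [hlen]; exact lt_add_one' 1)
      rw [hd1, hΘsem] at hy'
      have e := hy'.2 rfl
      subst e
      exact hy'le (hw.trans hRr)
    refine ⟨W, ?_, ?_⟩
    · rw [hr]; exact hWle
    · rw [sem, hd1, hd2]
      exact ⟨⟨hy, hw⟩, hπw⟩

end Bex

/-! ## Conjunction; a sharply bounded universal in front of a strict form -/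

section AndBall

variable {n : ℕ}

/-- **Conjunction of strict forms** (reduced to `HasStrictForm.bex`). [folklore] -/
theorem HasStrictForm.and {A B : StrictPred k n} (hA : HasStrictForm k A) (hB : HasStrictForm k B) :
    HasStrictForm k fun K _ _ xs => A K xs ∧ B K xs := by
  obtain ⟨r₁, π₁, hπ₁, h₁, h₁'⟩ := hA
  obtain ⟨r₂, π₂, hπ₂, h₂, h₂'⟩ := hB
  -- `A'(x̄, y) := π₁(x̄, y) ∧ B(x̄)` is strict
  have hA' : HasStrictForm k fun K _ _ (ys : Fin (n + 1) → K) =>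
      π₁.Realize (default : Empty → K) ys ∧ B K (fun i => ys (Fin.castSucc i)) := by
    have sem : ∀ (K : Type) [Language.boundedArith.Structure K] [(Language.qsym k).Structure K]
        [(qsymι k).IsExpansionOn K] [K ⊨ BASIC] (ys : Fin (n + 1) → K) (w : K),
        (substCtx π₁ (fun i => qv (Fin.castSucc i)) ⊓
          substCtx π₂ (Fin.snoc (fun i => qv ((Fin.castSucc i).castSucc)) (qv (Fin.last (n + 1))))).Realize
            default (Fin.snoc ys w) ↔
          π₁.Realize default ys ∧ π₂.Realize default (Fin.snoc (fun i => ys (Fin.castSucc i)) w) := by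
      intro K _ _ _ _ ys w
      simp only [realize_inf, realize_substCtx, realize_snoc_terms, Term.realize, Sum.elim_inr,
        Fin.snoc_castSucc, Fin.snoc_last]
    have er₂ : ∀ (K : Type) [Language.boundedArith.Structure K] (ys : Fin (n + 1) → K),
        (r₂.relabel (Sum.map id Fin.castSucc)).realize (Sum.elim (default : Empty → K) ys) =
          r₂.realize (Sum.elim default fun i => ys (Fin.castSucc i)) := by
      intro K _ ys
      rw [Term.realize_relabel]
      congr 1
      funext x; rcases x with x | i <;> simp
    refine ⟨r₂.relabel (Sum.map id Fin.castSucc),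
      substCtx π₁ (fun i => qv (Fin.castSucc i)) ⊓
        substCtx π₂ (Fin.snoc (fun i => qv ((Fin.castSucc i).castSucc)) (qv (Fin.last (n + 1)))),
      (isQF_substCtx hπ₁ _).inf (isQF_substCtx hπ₂ _), fun K _ _ _ _ hK ys => ?_,
      fun K _ _ _ _ hK hsat ys => ?_⟩
    · rintro ⟨w, hw, hπw⟩
      rw [sem] at hπw
      rw [er₂] at hw
      exact ⟨hπw.1, h₂ K hK _ ⟨w, hw, hπw.2⟩⟩
    · rintro ⟨hπ, hB⟩
      obtain ⟨w, hw, hπw⟩ := h₂' K hK hsat _ hB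
      refine ⟨w, ?_, ?_⟩
      · rw [er₂]; exact hw
      · rw [sem]; exact ⟨hπ, hπw⟩
  refine (hA'.bex r₁).of_imp (fun K _ _ _ _ hK xs h => ?_) (fun K _ _ _ _ hK hsat xs h => ?_)
  · obtain ⟨y, hy, hπ, hB⟩ := h
    simp only [Fin.snoc_castSucc] at hB
    exact ⟨h₁ K hK xs ⟨y, (mLe_iff _ _).1 hy, hπ⟩, hB⟩
  · obtain ⟨hA, hB⟩ := h
    obtain ⟨y, hy, hπ⟩ := h₁' K hK hsat xs hA
    refine ⟨y, (mLe_iff _ _).2 hy, hπ, ?_⟩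
    simp only [Fin.snoc_castSucc]
    exact hB

variable [hKB : K ⊨ BASIC]

omit [(Language.qsym k).Structure K] [(qsymι k).IsExpansionOn K] in
/-- `|s + s + 1| = |s| + 1` in a model of `BASIC`. [folklore] -/
theorem mLen_add_self_add_one (a : K) : mLen (a + a + 1) = mLen a + 1 := by
  rw [← two_mul, mLen_two_mul_add_one]

/-- **A sharply bounded universal quantifier in front of a strict form is strict**: the witnesses
`w_z ≤ r_A(x̄, z)` for `z ≤ |s(x̄)|` are collected into one code `W` (`exists_collect`, per
instance), and the strict form says "`W` decodes to witnesses for all `z ≤ |s|`", a sharply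
bounded universal over an open formula, which is open by the least-zero symbol
(`forall_le_len_iff_lt_lsearch`) — Case (5) of Buss's `Witness` and the `Σᵇᵢ₊₁`-replacement step
of Buss 1990, Prop. 16(b), model-theoretically. [cite: BussContempMath1990, §4, Prop. 16(b) (p. 16)] -/
theorem HasStrictForm.ballLen (s : Language.boundedArith.Term (Empty ⊕ Fin n)) {A : StrictPred k (n + 1)}
    (hA : HasStrictForm k A) :
    HasStrictForm k fun K _ _ xs => ∀ z, MLe z (mLen (s.realize (Sum.elim (default : Empty → K) xs))) →
      A K (Fin.snoc xs z) := by
  obtain ⟨rA, πA, hπA, hAback, hAforth⟩ := hA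
  -- bounds (terms of Buss's language over `x̄`)
  let rAs : Language.boundedArith.Term (Empty ⊕ Fin n) := substLastBA rA (Term.len s)
  let bS : Language.boundedArith.Term (Empty ⊕ Fin n) := Term.succ (s + s)
  let SS : Language.boundedArith.Term (Empty ⊕ Fin n) :=
    Term.smash (Term.succ (bS + bS)) (Term.succ (rAs + rAs))
  let r : Language.boundedArith.Term (Empty ⊕ Fin n) := Term.succ (SS + SS)
  -- terms over `(x̄, W, z)`
  let up2 : Language.boundedArith.Term (Empty ⊕ Fin n) → (Language.qsym k).Term (Empty ⊕ Fin (n + 2)) :=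
    fun t => ιt (t.relabel (Sum.map id (Fin.castSucc ∘ Fin.castSucc)))
  let Wv : (Language.qsym k).Term (Empty ⊕ Fin (n + 2)) := qv (Fin.last n).castSucc
  let zv : (Language.qsym k).Term (Empty ⊕ Fin (n + 2)) := qv (Fin.last (n + 1))
  let decz : (Language.qsym k).Term (Empty ⊕ Fin (n + 2)) :=
    Term.func (seqel : QSym k 4) ![up2 SS, up2 (Term.len rAs), Wv,
      Functions.apply₂ (QSym.ba BoundedArithFunc.add : QSym k 2) zv qone]
  let exz : Fin (n + 1) → Fin (n + 2) := Fin.snoc (fun i => (Fin.castSucc i).castSucc) (Fin.last (n + 1))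
  let rAz : (Language.qsym k).Term (Empty ⊕ Fin (n + 2)) := ιt (rA.relabel (Sum.map id exz))
  let Δ : (Language.qsym k).BoundedFormula Empty (n + 2) :=
    Term.le decz rAz ⊓ substCtx πA (Fin.snoc (Fin.snoc (fun i => qv ((Fin.castSucc i).castSucc)) zv) decz)
  have hΔ : Δ.IsQF := (IsAtomic.rel _ _).isQF.inf (isQF_substCtx hπA _)
  let s1 : Language.boundedArith.Term (Empty ⊕ Fin (n + 1)) := s.relabel (Sum.map id Fin.castSucc)
  let π : (Language.qsym k).BoundedFormula Empty (n + 1) :=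
    ∼(Term.le (lsTerm (charSym Δ) s1) (ιt (Term.len s1)))
  have hπ : π.IsQF := (IsAtomic.rel _ _).isQF.not
  -- semantics of `π` in any model of the theory: `W` decodes to witnesses for all `z ≤ |s|`
  have sem : ∀ (K : Type) [Language.boundedArith.Structure K] [(Language.qsym k).Structure K]
      [(qsymι k).IsExpansionOn K] [K ⊨ BASIC], K ⊨ univTheory k → ∀ (xs : Fin n → K) (W : K),
      π.Realize default (Fin.snoc xs W) ↔
        ∀ z, z ≤ mLen (s.realize (Sum.elim default xs)) →
          app (seqel (k := k)) ![SS.realize (Sum.elim default xs), mLen (rAs.realize (Sum.elim default xs)), W, z + 1] ≤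
              rA.realize (Sum.elim default (Fin.snoc xs z)) ∧
            πA.Realize default (Fin.snoc (Fin.snoc xs z)
              (app (seqel (k := k)) ![SS.realize (Sum.elim default xs), mLen (rAs.realize (Sum.elim default xs)), W, z + 1])) := by
    intro K _ _ _ _ hK xs W
    have hs1 : s1.realize (Sum.elim default (Fin.snoc xs W)) = s.realize (Sum.elim default xs) := by
      simp [s1, Term.realize_relabel, Sum.elim_comp_map, Fin.snoc_comp_castSucc]
    have hup2 : ∀ (t' : Language.boundedArith.Term (Empty ⊕ Fin n)) (z : K),
        (up2 t').realize (Sum.elim default (Fin.snoc (Fin.snoc xs W) z)) = t'.realize (Sum.elim default xs) := by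
      intro t' z
      simp [up2, Term.realize_relabel, Sum.elim_comp_map, snoc_snoc_comp_castSucc_castSucc]
    have hdecz : ∀ z : K, decz.realize (Sum.elim default (Fin.snoc (Fin.snoc xs W) z)) =
        app (seqel (k := k)) ![SS.realize (Sum.elim default xs), mLen (rAs.realize (Sum.elim default xs)), W, z + 1] := by
      intro z
      simp only [decz]
      rw [realize_func_vec4]
      simp only [hup2, realize_term_len, Wv, zv, Term.realize, Sum.elim_inr, Fin.snoc_last,
        Fin.snoc_castSucc, realize_qone, Term.realize_functions_apply₂, funMap_ba]
      rw [show Structure.funMap (L := Language.boundedArith) BoundedArithFunc.add ![z, (1 : K)] = z + 1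
        from mAdd_eq z 1]
    have hrAz : ∀ z : K, rAz.realize (Sum.elim default (Fin.snoc (Fin.snoc xs W) z)) =
        rA.realize (Sum.elim default (Fin.snoc xs z)) := by
      intro z
      simp only [rAz, realize_ιt, Term.realize_relabel, Sum.elim_comp_map, Function.comp_id]
      congr 1
      funext x
      rcases x with x | i
      · rfl
      · simp only [Sum.elim_inr, Function.comp_apply, exz]
        cases i using Fin.lastCases with
        | last => simp
        | cast i => simp
    have hΔsem : ∀ z : K, Δ.Realize default (Fin.snoc (Fin.snoc xs W) z) ↔
        app (seqel (k := k)) ![SS.realize (Sum.elim default xs), mLen (rAs.realize (Sum.elim default xs)), W, z + 1] ≤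
            rA.realize (Sum.elim default (Fin.snoc xs z)) ∧
          πA.Realize default (Fin.snoc (Fin.snoc xs z)
            (app (seqel (k := k)) ![SS.realize (Sum.elim default xs), mLen (rAs.realize (Sum.elim default xs)), W, z + 1])) := by
      intro z
      simp only [Δ, zv, realize_inf, realize_qle, hdecz, hrAz, realize_substCtx, realize_snoc_terms,
        Term.realize, Sum.elim_inr, Fin.snoc_castSucc, Fin.snoc_last]
    have hχ := fun z => app_charSym hK hΔ (Fin.snoc (Fin.snoc xs W) z)
    have hfl := forall_le_len_iff_lt_lsearch hK (charSym Δ) s1 (Fin.snoc xs W) fun z => (hχ z).2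
    simp only [π, realize_not, realize_qle, Term.realize, Sum.elim_inr, realize_ιt, realize_term_len,
      hs1, not_le]
    rw [hs1] at hfl
    refine hfl.symm.trans (forall_congr' fun z => imp_congr_right fun _ => ?_)
    rw [(hχ z).1, hΔsem]
  refine ⟨r, π, hπ, fun K _ _ _ _ hK xs => ?_, fun K _ _ _ _ hK hsat xs => ?_⟩
  · -- decoding direction (any model)
    rintro ⟨W, -, hW⟩ z hz
    rw [mLe_iff] at hz
    have hΔz := (sem K hK xs W).1 hW z hz
    exact hAback K hK (Fin.snoc xs z) ⟨_, hΔz.1, hΔz.2⟩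
  · -- coding direction (Herbrand-saturated model): collect witnesses
    intro hall
    set R : K := rAs.realize (Sum.elim default xs) with hR
    set b : K := bS.realize (Sum.elim default xs) with hb
    set Sv : K := SS.realize (Sum.elim default xs) with hSv
    have hbv : b = s.realize (Sum.elim default xs) + s.realize (Sum.elim default xs) + 1 := by
      simp [hb, bS, mSucc_eq, mAdd_eq]
    have hSSv : Sv = mSmash (b + b + 1) (R + R + 1) := by
      simp [hSv, SS, hb, hR, mSucc_eq, mAdd_eq]
    have hr : r.realize (Sum.elim (default : Empty → K) xs) = Sv + Sv + 1 := by
      simp [r, mSucc_eq, mAdd_eq, hSv]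
    have hlenb : mLen b = mLen (s.realize (Sum.elim (default : Empty → K) xs)) + 1 := by
      rw [hbv, mLen_add_self_add_one]
    have hRr : ∀ z : K, z ≤ mLen (s.realize (Sum.elim (default : Empty → K) xs)) →
        rA.realize (Sum.elim default (Fin.snoc xs z)) ≤ R := by
      intro z hz
      simp only [hR, rAs, realize_substLastBA, realize_term_len]
      refine realize_mono hK rA fun a => ?_
      rcases a with e | i
      · exact le_rfl
      · cases i using Fin.lastCases with
        | last => simpa using hz
        | cast i => simp
    let zT : (Language.qsym k).Term (Empty ⊕ Fin (n + 3)) := qv ((Fin.last n).castSucc.castSucc)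
    let wT : (Language.qsym k).Term (Empty ⊕ Fin (n + 3)) := qv (Fin.last (n + 2))
    let ex3 : Fin (n + 1) → Fin (n + 3) :=
      Fin.snoc (fun i => ((Fin.castSucc i).castSucc).castSucc) ((Fin.last n).castSucc.castSucc)
    let rA3 : (Language.qsym k).Term (Empty ⊕ Fin (n + 3)) := ιt (rA.relabel (Sum.map id ex3))
    let len3 : (Language.qsym k).Term (Empty ⊕ Fin (n + 3)) :=
      ιt ((Term.len s).relabel (Sum.map id (Fin.castSucc ∘ Fin.castSucc ∘ Fin.castSucc)))
    let Θ : (Language.qsym k).BoundedFormula Empty (n + 3) :=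
      Term.le zT len3 ⟹ (Term.le wT rA3 ⊓
        substCtx πA (Fin.snoc (Fin.snoc (fun i => qv (((Fin.castSucc i).castSucc).castSucc)) zT) wT))
    have hΘ : Θ.IsQF :=
      (IsAtomic.rel _ _).isQF.imp ((IsAtomic.rel _ _).isQF.inf (isQF_substCtx hπA _))
    have hΘsem : ∀ z u w : K, Θ.Realize default (Fin.snoc (Fin.snoc (Fin.snoc xs z) u) w) ↔
        (z ≤ mLen (s.realize (Sum.elim default xs)) →
          w ≤ rA.realize (Sum.elim default (Fin.snoc xs z)) ∧
            πA.Realize default (Fin.snoc (Fin.snoc xs z) w)) := by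
      intro z u w
      have e3 : (Sum.elim (default : Empty → K) (Fin.snoc (Fin.snoc (Fin.snoc xs z) u) w) ∘ Sum.map id ex3) =
          Sum.elim default (Fin.snoc xs z) := by
        funext x
        rcases x with x | i
        · rfl
        · simp only [Function.comp_apply, Sum.map_inr, Sum.elim_inr, ex3]
          cases i using Fin.lastCases with
          | last => simp
          | cast i => simp
      have el : (Sum.elim (default : Empty → K) (Fin.snoc (Fin.snoc (Fin.snoc xs z) u) w) ∘
          Sum.map id (Fin.castSucc ∘ Fin.castSucc ∘ Fin.castSucc)) = Sum.elim default xs := by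
        funext x
        rcases x with x | i
        · rfl
        · simp
      simp only [Θ, zT, wT, rA3, len3, realize_imp, realize_inf, realize_qle, Term.realize,
        Sum.elim_inr, Fin.snoc_castSucc, Fin.snoc_last, realize_ιt, Term.realize_relabel, e3, el,
        realize_term_len, realize_substCtx, realize_snoc_terms]
    have htot : ∀ z u : K, ∃ w : K, Θ.Realize default (Fin.snoc (Fin.snoc (Fin.snoc xs z) u) w) := by
      intro z u
      by_cases hz : z ≤ mLen (s.realize (Sum.elim default xs))
      · obtain ⟨w, hw, hπw⟩ := hAforth K hK hsat (Fin.snoc xs z) (hall z ((mLe_iff _ _).2 hz))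
        exact ⟨w, (hΘsem z u w).2 fun _ => ⟨hw, hπw⟩⟩
      · exact ⟨0, (hΘsem z u 0).2 fun h => absurd h hz⟩
    obtain ⟨W, hWle, -, hWstep⟩ := exists_collect hK hsat hΘ xs htot b R
    rw [← hSSv] at hWle hWstep
    refine ⟨W, by rw [hr]; exact hWle, (sem K hK xs W).2 fun z hz => ?_⟩
    have hzb : z < mLen b := by rw [hlenb]; exact (lt_add_one_iff' _ _).2 hz
    obtain ⟨y, hy, hyle⟩ := hWstep z hzb
    rw [hΘsem] at hy
    obtain ⟨hyr, hπy⟩ := hy hz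
    have hdy := hyle (hyr.trans (hRr z hz))
    rw [hdy]
    exact ⟨hyr, hπy⟩

end AndBall

/-! ## The induction on the class -/

section Induction

/-- **Strict forms of `Σᵇᵢ` formulas and of negations of `Πᵇᵢ` formulas, `i ≤ k + 2`**
(simultaneous induction on the class; Buss 1990, §4, Prop. 14 / Prop. 16 model-theoretically).
[cite: BussContempMath1990, §4, Prop. 16 (p. 16)] -/
theorem hasStrictForm_of_isSigmab_and_of_isPib (i : ℕ) :
    (∀ {n : ℕ} {θ : Language.boundedArith.BoundedFormula Empty n}, IsSigmab i θ → i ≤ k + 2 →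
      HasStrictForm k fun K _ _ xs => θ.Realize (default : Empty → K) xs) ∧
    (∀ {n : ℕ} {θ : Language.boundedArith.BoundedFormula Empty n}, IsPib i θ → i ≤ k + 2 →
      HasStrictForm k fun K _ _ xs => ¬ θ.Realize (default : Empty → K) xs) := by
  -- the ten cases, shared by both inductions
  have c1 : ∀ {i n : ℕ} {θ : Language.boundedArith.BoundedFormula Empty n}, IsSharplyBounded θ →
      i ≤ k + 2 → HasStrictForm k fun K _ _ xs => θ.Realize (default : Empty → K) xs :=
    fun h _ => (hasStrictForm_of_cert (Or.inl (.of_isSharplyBounded h))).1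
  have c2 : ∀ {i n : ℕ} {θ : Language.boundedArith.BoundedFormula Empty n}, IsPib i θ →
      (i ≤ k + 2 → HasStrictForm k fun K _ _ xs => ¬ θ.Realize (default : Empty → K) xs) →
      i + 1 ≤ k + 2 → HasStrictForm k fun K _ _ xs => θ.Realize (default : Empty → K) xs :=
    fun h _ hi => (hasStrictForm_of_cert (Or.inr (IsPib.mono_holds (Nat.le_of_succ_le_succ hi) h))).1
  have c3 : ∀ {i n : ℕ} {φ ψ : Language.boundedArith.BoundedFormula Empty n}, IsPib (i + 1) φ →
      IsSigmab (i + 1) ψ →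
      (i + 1 ≤ k + 2 → HasStrictForm k fun K _ _ xs => ¬ φ.Realize (default : Empty → K) xs) →
      (i + 1 ≤ k + 2 → HasStrictForm k fun K _ _ xs => ψ.Realize (default : Empty → K) xs) →
      i + 1 ≤ k + 2 → HasStrictForm k fun K _ _ xs => (φ.imp ψ).Realize (default : Empty → K) xs :=
    fun _ _ ih₁ ih₂ hi => ((ih₁ hi).or (ih₂ hi)).of_iff fun K _ _ _ _ _ xs => by
      simp only [realize_imp]; exact (imp_iff_not_or).symm
  have c4 : ∀ {i n : ℕ} (t : Language.boundedArith.Term (Empty ⊕ Fin n))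
      {η : Language.boundedArith.BoundedFormula Empty (n + 1)}, IsSigmab (i + 1) η →
      (i + 1 ≤ k + 2 → HasStrictForm k fun K _ _ xs => η.Realize (default : Empty → K) xs) →
      i + 1 ≤ k + 2 → HasStrictForm k fun K _ _ xs => (bexLE t η).Realize (default : Empty → K) xs :=
    by
      intro i n t η _ ih hi
      exact ((ih hi).bex t).of_iff fun K _ _ _ _ _ xs => by rw [realize_bexLE']
  have c5 : ∀ {i n : ℕ} (s : Language.boundedArith.Term (Empty ⊕ Fin n))
      {η : Language.boundedArith.BoundedFormula Empty (n + 1)}, IsSigmab (i + 1) η →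
      (i + 1 ≤ k + 2 → HasStrictForm k fun K _ _ xs => η.Realize (default : Empty → K) xs) →
      i + 1 ≤ k + 2 → HasStrictForm k fun K _ _ xs => (ballLELen s η).Realize (default : Empty → K) xs :=
    by
      intro i n s η _ ih hi
      exact ((ih hi).ballLen s).of_iff fun K _ _ _ _ _ xs => by rw [realize_ballLELen']
  have c6 : ∀ {i n : ℕ} {θ : Language.boundedArith.BoundedFormula Empty n}, IsSharplyBounded θ →
      i ≤ k + 2 → HasStrictForm k fun K _ _ xs => ¬ θ.Realize (default : Empty → K) xs :=
    fun h _ => (hasStrictForm_of_cert (Or.inl (.of_isSharplyBounded h))).2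
  have c7 : ∀ {i n : ℕ} {θ : Language.boundedArith.BoundedFormula Empty n}, IsSigmab i θ →
      (i ≤ k + 2 → HasStrictForm k fun K _ _ xs => θ.Realize (default : Empty → K) xs) →
      i + 1 ≤ k + 2 → HasStrictForm k fun K _ _ xs => ¬ θ.Realize (default : Empty → K) xs :=
    fun h _ hi => (hasStrictForm_of_cert (Or.inl (IsSigmab.mono_holds (Nat.le_of_succ_le_succ hi) h))).2
  have c8 : ∀ {i n : ℕ} {φ ψ : Language.boundedArith.BoundedFormula Empty n}, IsSigmab (i + 1) φ →
      IsPib (i + 1) ψ →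
      (i + 1 ≤ k + 2 → HasStrictForm k fun K _ _ xs => φ.Realize (default : Empty → K) xs) →
      (i + 1 ≤ k + 2 → HasStrictForm k fun K _ _ xs => ¬ ψ.Realize (default : Empty → K) xs) →
      i + 1 ≤ k + 2 → HasStrictForm k fun K _ _ xs => ¬ (φ.imp ψ).Realize (default : Empty → K) xs :=
    fun _ _ ih₁ ih₂ hi => ((ih₁ hi).and (ih₂ hi)).of_iff fun K _ _ _ _ _ xs => by
      simp only [realize_imp]; exact Classical.not_imp.symm
  have c9 : ∀ {i n : ℕ} (t : Language.boundedArith.Term (Empty ⊕ Fin n))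
      {η : Language.boundedArith.BoundedFormula Empty (n + 1)}, IsPib (i + 1) η →
      (i + 1 ≤ k + 2 → HasStrictForm k fun K _ _ xs => ¬ η.Realize (default : Empty → K) xs) →
      i + 1 ≤ k + 2 → HasStrictForm k fun K _ _ xs => ¬ (ballLE t η).Realize (default : Empty → K) xs :=
    by
      intro i n t η _ ih hi
      exact ((ih hi).bex t).of_iff fun K _ _ _ _ _ xs => by
        rw [realize_ballLE']; push Not; rfl
  have c10 : ∀ {i n : ℕ} (s : Language.boundedArith.Term (Empty ⊕ Fin n))
      {η : Language.boundedArith.BoundedFormula Empty (n + 1)}, IsPib (i + 1) η →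
      (i + 1 ≤ k + 2 → HasStrictForm k fun K _ _ xs => ¬ η.Realize (default : Empty → K) xs) →
      i + 1 ≤ k + 2 → HasStrictForm k fun K _ _ xs => ¬ (bexLELen s η).Realize (default : Empty → K) xs :=
    by
      intro i n s η _ ih hi
      exact ((ih hi).ballLen s).of_iff fun K _ _ _ _ _ xs => by
        rw [realize_bexLELen']; push Not; rfl
  constructor
  · intro n θ h
    refine IsSigmab.rec
      (motive_1 := fun i n θ _ => i ≤ k + 2 → HasStrictForm k fun K _ _ xs => θ.Realize (default : Empty → K) xs)
      (motive_2 := fun i n θ _ => i ≤ k + 2 → HasStrictForm k fun K _ _ xs => ¬ θ.Realize (default : Empty → K) xs)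
      ?_ ?_ ?_ ?_ ?_ ?_ ?_ ?_ ?_ ?_ h
    · intro i n θ h; exact c1 h
    · intro i n θ h ih; exact c2 h ih
    · intro i n φ ψ h₁ h₂ ih₁ ih₂; exact c3 h₁ h₂ ih₁ ih₂
    · intro i n t η h ih; exact c4 t h ih
    · intro i n s η h ih; exact c5 s h ih
    · intro i n θ h; exact c6 h
    · intro i n θ h ih; exact c7 h ih
    · intro i n φ ψ h₁ h₂ ih₁ ih₂; exact c8 h₁ h₂ ih₁ ih₂
    · intro i n t η h ih; exact c9 t h ih
    · intro i n s η h ih; exact c10 s h ih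
  · intro n θ h
    refine IsPib.rec
      (motive_1 := fun i n θ _ => i ≤ k + 2 → HasStrictForm k fun K _ _ xs => θ.Realize (default : Empty → K) xs)
      (motive_2 := fun i n θ _ => i ≤ k + 2 → HasStrictForm k fun K _ _ xs => ¬ θ.Realize (default : Empty → K) xs)
      ?_ ?_ ?_ ?_ ?_ ?_ ?_ ?_ ?_ ?_ h
    · intro i n θ h; exact c1 h
    · intro i n θ h ih; exact c2 h ih
    · intro i n φ ψ h₁ h₂ ih₁ ih₂; exact c3 h₁ h₂ ih₁ ih₂
    · intro i n t η h ih; exact c4 t h ih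
    · intro i n s η h ih; exact c5 s h ih
    · intro i n θ h; exact c6 h
    · intro i n θ h ih; exact c7 h ih
    · intro i n φ ψ h₁ h₂ ih₁ ih₂; exact c8 h₁ h₂ ih₁ ih₂
    · intro i n t η h ih; exact c9 t h ih
    · intro i n s η h ih; exact c10 s h ih

/-- **Every `Πᵇₖ₊₂` formula is equivalent, in every Herbrand-saturated model of `univTheory k`, to
a universal formula of `Language.qsym k`**, uniformly: with `ψ := ∀ w (w ≤ r → ¬π)` for the
strict form `(r, π)` of `¬θ`, `θ → ψ` in every expansion of a model of `T₂ᵏ⁺¹` to a model of the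
theory and `ψ → θ` in every Herbrand-saturated model — the field `exists_universal` of
`HerbrandRouteData (k + 1)` (from Buss 1990, Prop. 16, model-theoretically).
[cite: BussContempMath1990, §4, Prop. 16 (p. 16)] -/
theorem exists_universal_of_isPib {n : ℕ} (φ : Language.boundedArith.BoundedFormula Empty n)
    (hφ : IsPib (k + 2) φ) :
    ∃ ψ : (Language.qsym k).BoundedFormula Empty n, ψ.IsUniversal ∧
      (∀ (M : Type) [Language.boundedArith.Structure M] [(Language.qsym k).Structure M],
        (qsymι k).IsExpansionOn M → M ⊨ T2 (k + 1) → M ⊨ univTheory k → ∀ xs : Fin n → M,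
          φ.Realize default xs → ψ.Realize default xs) ∧
      (∀ (K : Type) [(Language.qsym k).Structure K], K ⊨ univTheory k →
        IsHerbrandSaturated (Language.qsym k) K → ∀ xs : Fin n → K,
          ψ.Realize default xs →
            BoundedFormula.Realize (L := Language.qsym k) ((qsymι k).onBoundedFormula φ) default xs) := by
  obtain ⟨r, π, hπ, hback, hforth⟩ := (hasStrictForm_of_isSigmab_and_of_isPib (k := k) (k + 2)).2 hφ le_rfl
  refine ⟨∀' (Term.le (qv (Fin.last n)) (upT r) ⟹ ∼π),
    ((IsAtomic.rel _ _).isQF.imp hπ.not).isUniversal.all, fun M _ _ hexp hMT hMU xs hφM => ?_,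
    fun K _ hK hsat xs hψ => ?_⟩
  · -- in an expansion of a model of `T₂ᵏ⁺¹`: `φ → ψ` by the decoding direction
    haveI : (qsymι k).IsExpansionOn M := hexp
    haveI : M ⊨ BASIC := hMT.mono (BASIC_subset_T2 _)
    simp only [realize_all, realize_imp, realize_not, realize_qle, Term.realize, Sum.elim_inr,
      Fin.snoc_last, realize_upT]
    intro w hw hπw
    exact hback M hMU xs ⟨w, hw, hπw⟩ hφM
  · -- in a Herbrand-saturated model of the theory: `ψ → φ` by the coding direction
    letI : Language.boundedArith.Structure K := (qsymι k).reduct K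
    haveI : (qsymι k).IsExpansionOn K := LHom.isExpansionOn_reduct _ _
    haveI : K ⊨ BASIC := model_BASIC_of_model_univTheory hK
    rw [LHom.realize_onBoundedFormula]
    simp only [realize_all, realize_imp, realize_not, realize_qle, Term.realize, Sum.elim_inr,
      Fin.snoc_last, realize_upT] at hψ
    by_contra hθ
    obtain ⟨w, hw, hπw⟩ := hforth K hK hsat xs hθ
    exact hψ w hw hπw

end Induction

end QSym

end Literature.Computability.MetaComplexity
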